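import Literature.AlgebraicGeometry.Resolution.VertexBlowupProjectionFibres
import Literature.AlgebraicGeometry.Resolution.BlowupsExistence
import HarnessLib

/-!
# de Jong 1996, proof of Lemma 4.11: the blow-up of `ℙ^{d+1}` in the vertex and its projection — DISCHARGED

Topic: `Literature/AlgebraicGeometry/Resolution`. The named fact
`DeJong1996VertexBlowupProjection` (`AlterationsLemma411Vertex.lean`) — "Let `P̃ → ℙ^{d+1}` be
the blowing up in `p`, then the projection `q : P̃ → ℙ^d` … is smooth (a `ℙ¹`-bundle), every
fibre is an irreducible curve meeting `E = b⁻¹(p) ≅ ℙ^d`", normalised at the vertex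
`p = (0 : … : 0 : 1)`, together with the chart description `q = pr_p ∘ b` off `E`
(`DeJong1996.IsVertexProjection`) — is PROVED:
`DeJong1996VertexBlowupProjection_holds`.

The construction (files `PointBlowupAlgebraCharts`, `VertexBlowupCharts`,
`PointBlowupProjectionRingHom`, `PointBlowupSectionRingHom`, `VertexBlowupRationalFunctions`,
`VertexBlowupProjectionMorphism`, `VertexProjectionRingHomSmooth`, `VertexBlowupProjectionSmooth`,
`PointBlowupFibreRings`, `VertexBlowupProjectionFibres`): take ANY blowing up
`b : P̃ → ℙ^{d+1}_k` of the vertex (it exists, `exists_isBlowup`, and is integral and birational);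
`q : P̃ → ℙ^d` is the morphism to projective space defined by the rational functions
`b^*(x₀/x_{d+1}), …, b^*(x_d/x_{d+1})` (Hartshorne II 7.1 via `toProjOfVec`), defined everywhere
since on the charts `Spec k[X₀, …, X_d][I/Xᵢ]` of `P̃` over `D₊(x_{d+1})` the ratios `X_j/Xᵢ` are
regular; `q` is over `k`, equals `pr_p ∘ b` off `E` (checked on function fields), is smooth
(`pr_p` is an `𝔸¹`-bundle off the vertex, and on the charts `q` is `Spec` of
`(k[y]_{(yᵢ)})₀ → k[X][I/Xᵢ] ≅ (k[y]_{(yᵢ)})₀[T]`), the exceptional divisor is a section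
(the retraction `T ↦ 0`), and every fibre is covered by affine lines over the residue field all
meeting the line off `E`, hence irreducible of dimension `1`.

## Sources

* A. J. de Jong, *Smoothness, semi-stability and alterations*, Publ. Math. IHÉS 83 (1996),
  proof of Lemma 4.11, p. 68. [DeJong1996]
* R. Hartshorne, *Algebraic Geometry* (1977), II Thm. 7.1, II Prop. 7.13–7.16, II Ex. 3.22.
  [Hartshorne1977]
* D. Eisenbud, J. Harris, *3264 and All That* (2016), §9.3.2, Prop. 9.11. [EisenbudHarris2016]
-/

noncomputable section

open CategoryTheory CategoryTheory.Limits AlgebraicGeometry TopologicalSpace HomogeneousLocalization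

attribute [local instance] MvPolynomial.gradedAlgebra

namespace Literature.AlgebraicGeometry.Resolution

universe u

open Literature.AlgebraicGeometry.Motives (projectiveSpace projectiveSpace_hom_eq_toSpec)
open Literature.AlgebraicGeometry.Motives.Segre (grading chartι toSpec)

namespace DeJong1996

variable {d : ℕ} {k : Type u} [Field k]
variable {P : Scheme.{u}} (b : P ⟶ Proj (grading (Fin (d + 1 + 1)) k)) [IsIntegral P] [IsDominant b]
  (hb : IsBlowup b (vertexIdealSheaf d k))

/-- **`(b, q)` is the blow-up of `ℙ^{d+1}` in the vertex with its projection**, for every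
blowing up `b` of the vertex and `q := vertexBlowupProjection b hb`: all the fields of
`DeJong1996.PointBlowupProjection` (read with `ℙ^{d+1}`, `ℙ^d` in the `Proj` spelling).
[cite: DeJong1996, Lemma 4.11 (proof), p. 68] -/
theorem pointBlowupProjection_vertexBlowupProjection :
    PointBlowupProjection d k (vertex d k) (b := b) (vertexBlowupProjection b hb) where
  isClosed_singleton := isClosed_singleton_vertex d k
  isBlowup := hb
  comp_hom := by
    change vertexBlowupProjection b hb ≫ (projectiveSpace d k).hom = b ≫ (projectiveSpace (d + 1) k).hom
    rw [projectiveSpace_hom_eq_toSpec, projectiveSpace_hom_eq_toSpec]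
    exact vertexBlowupProjection_toSpec b hb
  smooth := smooth_vertexBlowupProjection b hb
  irreducibleSpace_fiber y := irreducibleSpace_fiber b hb y
  topologicalKrullDim_fiber_le_one y := topologicalKrullDim_fiber_le_one b hb y
  exists_apply_eq y := exists_apply_eq_vertex hb y

end DeJong1996

/-- **de Jong 1996, proof of Lemma 4.11 — the blow-up of `ℙ^{d+1}_k` in the vertex and its
projection to `ℙ^d`, DISCHARGED**: for every field `k` (algebraically closed or not) and `d`,
there are `P̃`, `b : P̃ → ℙ^{d+1}` the blowing up in the vertex and `q : P̃ → ℙ^d` over `k`,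
smooth, with irreducible fibres of dimension `≤ 1` all meeting `E = b⁻¹(vertex)`, and
`q = pr_{vertex} ∘ b` off `E`. [cite: DeJong1996, Lemma 4.11 (proof), p. 68] -/
theorem DeJong1996VertexBlowupProjection_holds : DeJong1996VertexBlowupProjection := by
  intro k _ _ d
  obtain ⟨P, b, hb⟩ := exists_isBlowup (Proj (grading (Fin (d + 1 + 1)) k)) (DeJong1996.vertexIdealSheaf d k)
  haveI := DeJong1996.isIntegral_of_isBlowup_vertex hb
  haveI := DeJong1996.isDominant_of_isBlowup_vertex hb
  exact ⟨P, b, DeJong1996.vertexBlowupProjection b hb,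
    DeJong1996.pointBlowupProjection_vertexBlowupProjection b hb,
    DeJong1996.isVertexProjection_vertexBlowupProjection b hb⟩

end Literature.AlgebraicGeometry.Resolution

end
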